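import Mathlib
import Summits.AtomisticToContinuum.Crystallization.Theses.ChessboardParticlePlanes
import Summits.AtomisticToContinuum.Crystallization.Theorems.ChargedEnergyGap.Negative.FarCopies
import HarnessLib

/-!
# Sub-window inheritance of laminarity — stub `stub_subWindow` of line `Sketch`
(crux `LjLaminarWindows`, stmt-AtomisticToContinuum-6711), skeleton rev. 17, lead c11

The laminarity clause of the crux says: for the window (closed `L`-ball) around particle `i` there are a
linear isometry `A` and a `3/4`-separated height set `T ⊂ ℝ` such that every particle `j` of the window is
within `η` of `T` in the rotated third coordinate `(A (x j - x i)) 2`.  This file proves the registered stub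
`stub_subWindow`: a laminar `L'`-window around `x i` makes the `L`-window around any `x p` with
`dist (x p) (x i) + L ≤ L'` laminar, with the SAME isometry `A` and the translated height set
`T' = (· - (A (x p - x i)) 2) '' T` (a translate of a `3/4`-separated set is `3/4`-separated).  Pure Mathlib:
`dist_triangle`, linearity of `A` (`map_sub`) and of the coordinate maps (`PiLp.sub_apply`).
-/

noncomputable section

open scoped BigOperators
open Summit.AtomisticToContinuum.Crystallization.Theorems.ChargedEnergyGapNegative

namespace Summit.AtomisticToContinuum.Crystallization.Theorems.LjLaminarWindowsSketch

/-- **Registered stub `stub_subWindow` of skeleton rev. 17 (line `Sketch`, lead c11): laminarity is inherited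
by sub-windows.** If the `L'`-window around `x i` is `η`-laminar for the isometry `A` and the `3/4`-separated
height set `T`, and `dist (x p) (x i) + L ≤ L'`, then the `L`-window around `x p` is `η`-laminar for the same
`A` and the translated height set `T' = (· - (A (x p - x i)) 2) '' T`.  Indeed `T'` is `3/4`-separated because
`|(t - a) - (t' - a)| = |t - t'|`; and for `dist (x j) (x p) ≤ L` the triangle inequality gives
`dist (x j) (x i) ≤ L'`, whence some `t ∈ T` with `|(A (x j - x i)) 2 - t| ≤ η`, and
`(A (x j - x p)) 2 - (t - a) = (A (x j - x i)) 2 - t` since `x j - x p = (x j - x i) - (x p - x i)` and `A` and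
the coordinate maps are linear. [folklore] -/
theorem stub_subWindow :
    ∀ (N : ℕ) (x : Fin N → E3) (i p : Fin N) (L L' η : ℝ) (A : E3 →ₗᵢ[ℝ] E3) (T : Set ℝ),
      (∀ t ∈ T, ∀ t' ∈ T, t ≠ t' → (3 : ℝ) / 4 ≤ |t - t'|) →
      (∀ j : Fin N, dist (x j) (x i) ≤ L' → ∃ t ∈ T, |(A (x j - x i)) 2 - t| ≤ η) →
      dist (x p) (x i) + L ≤ L' →
      ∃ T' : Set ℝ, (∀ t ∈ T', ∀ t' ∈ T', t ≠ t' → (3 : ℝ) / 4 ≤ |t - t'|) ∧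
        ∀ j : Fin N, dist (x j) (x p) ≤ L → ∃ t ∈ T', |(A (x j - x p)) 2 - t| ≤ η := by
  intro N x i p L L' η A T hT hlam hL
  refine ⟨(fun t => t - (A (x p - x i)) 2) '' T, ?_, ?_⟩
  · rintro _ ⟨t, ht, rfl⟩ _ ⟨t', ht', rfl⟩ hne
    have hne' : t ≠ t' := fun h => hne (by rw [h])
    have key := hT t ht t' ht' hne'
    rwa [sub_sub_sub_cancel_right]
  · intro j hj
    have hji : dist (x j) (x i) ≤ L' :=
      calc dist (x j) (x i) ≤ dist (x j) (x p) + dist (x p) (x i) := dist_triangle _ _ _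
        _ ≤ L + dist (x p) (x i) := by linarith
        _ ≤ L' := by linarith
    obtain ⟨t, ht, hηt⟩ := hlam j hji
    refine ⟨t - (A (x p - x i)) 2, ⟨t, ht, rfl⟩, ?_⟩
    have hcoord : (A (x j - x p)) 2 = (A (x j - x i)) 2 - (A (x p - x i)) 2 := by
      rw [← PiLp.sub_apply, ← map_sub, sub_sub_sub_cancel_right]
    rwa [hcoord, sub_sub_sub_cancel_right]

end Summit.AtomisticToContinuum.Crystallization.Theorems.LjLaminarWindowsSketch

end
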